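import Summits.Schanuel.Schanuel.Theorems.ZilberEacExpExpDensityGeneral
import Summits.Schanuel.Schanuel.Theorems.ZilberEacMovingPolydiscCentres
import Summits.Schanuel.Schanuel.Theorems.ZilberEacMovingLineDefs
import HarnessLib

/-!
# MIXED fibres with a DECOUPLED pure block, I: the one-variable inputs

Zilber's Exponential-Algebraic Closedness, case ladder (host summit Schanuel, cell `pub-schanuel`,
seat 2, gen 11).  O51 (d) asked for MIXED fibres — pure targets `e^{xⱼ} = Aⱼ(x)` next to balancing
ones — over an explosion base, where neither the balance theorem (all `fⱼ ≠ 0`, gen 10) nor the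
pure theorem (all `Fⱼ = 0`, `ZilberEacPureTargetsDensity`) applies.  When the pure block is
DECOUPLED from the balancing variable — `Aⱼ = aⱼ(xⱼ)` univariate for `j ≥ 1` — the `(s+2)`-fold

  `W = {x_{s+1} = g(x), y₀ = A₀(x) + y_{s+1} f₀(y_{s+1}), yⱼ = aⱼ(xⱼ) (1 ≤ j ≤ s)}`

fibres over the discrete set `M = {ν ∈ ℂˢ : e^{νⱼ} = aⱼ(νⱼ)}` (a product of infinite sets, hence
Zariski dense), and on each slice `x' = ν` the remaining equation
`e^{z} = A₀(z, ν) + e^{p_ν(z)} f₀(e^{p_ν(z)})`, `p_ν(z) = g(z, ν)`, is gen 8's ONE-variable exp–exp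
balance (`exists_solution_expExp_quadratic` / `exists_solution_expExp_general`): solutions with
`Re p_ν(z) ≥ ρ m`, `‖p_ν(z)‖ ≤ C m^{D}` — i.e. ON the line `x' = ν` with an exponentially large
power coordinate.  That is exactly the input of THEOREM K (`unprojectedDense_polyFibredGraph_of_nearLine`,
slopes `λ = 0`, offsets `ν ∈ M`).

This file: `exists_norm_le_of_polynomial_eval` (`‖z‖ ≤ K(1 + ‖p(z)‖)`),
`setOf_exp_eq_polynomial_eval_infinite` (`{e^t = a(t)}` is infinite, via the one-variable moving
polydisc), and `exists_balance_solutions_for_nearLine` — gen 8's balance (both degree cases)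
repackaged in THEOREM K's format: `‖z_m‖ → ∞`, `‖z_m‖^N ≤ e^{Re p(z_m)}` eventually.  The density
theorem is `ZilberEacMixedDecoupledDensity`.

HONEST FRAMING: explicit families inside an OPEN cell; the COUPLED mixed case (`A₁` depending on
`x₀`) stays open (O52 (d)); `EC(3,2)` OPEN; NOT Schanuel's conjecture; EAC ⇏ SC.
-/

noncomputable section

open Complex MvPolynomial Filter Topology
open Literature.NumberTheory.Transcendental Literature.ModelTheory.Zilber
  Literature.ModelTheory.ExponentialFields

set_option linter.dupNamespace false

namespace Summit.Schanuel.Schanuel.Theorems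

/-! ## Part A. One-variable inputs -/

section OneVariable

/-- `‖z‖ ≤ K (1 + ‖p(z)‖)` for a polynomial of positive degree. [folklore] -/
theorem exists_norm_le_of_polynomial_eval (p : Polynomial ℂ) (hp : 0 < p.natDegree) :
    ∃ K : ℝ, 0 < K ∧ ∀ z : ℂ, ‖z‖ ≤ K * (1 + ‖p.eval z‖) := by
  classical
  set d := p.natDegree with hd
  have hp0 : p ≠ 0 := by rintro rfl; simp [hd] at hp
  set lc := p.leadingCoeff with hlc
  have hlc0 : 0 < ‖lc‖ := norm_pos_iff.2 (Polynomial.leadingCoeff_ne_zero.2 hp0)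
  set B : ℝ := ∑ k ∈ Finset.range d, ‖p.coeff k‖ with hB
  have hB0 : 0 ≤ B := Finset.sum_nonneg fun _ _ => norm_nonneg _
  refine ⟨1 + (B + 1) / ‖lc‖, by positivity, fun z => ?_⟩
  have hK1 : (1 : ℝ) ≤ 1 + (B + 1) / ‖lc‖ := by
    have : 0 ≤ (B + 1) / ‖lc‖ := by positivity
    linarith
  by_cases hz1 : ‖z‖ ≤ 1
  · calc ‖z‖ ≤ 1 := hz1
      _ ≤ (1 + (B + 1) / ‖lc‖) * (1 + ‖p.eval z‖) := by
          have := norm_nonneg (p.eval z); nlinarith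
  rw [not_le] at hz1
  by_cases hsmall : ‖lc‖ * ‖z‖ ≤ B
  · have h1 : ‖z‖ ≤ B / ‖lc‖ := by rw [le_div_iff₀ hlc0]; linarith
    have h2 : B / ‖lc‖ ≤ (B + 1) / ‖lc‖ := div_le_div_of_nonneg_right (by linarith) hlc0.le
    calc ‖z‖ ≤ (B + 1) / ‖lc‖ := h1.trans h2
      _ ≤ (1 + (B + 1) / ‖lc‖) * (1 + ‖p.eval z‖) := by
          have := norm_nonneg (p.eval z)
          have : 0 ≤ (B + 1) / ‖lc‖ := by positivity
          nlinarith
  rw [not_le] at hsmall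
  -- `‖z‖ ‖p(z)‖ ≥ ‖z‖^d (‖lc‖ ‖z‖ - B) ≥ ‖z‖ (‖lc‖ ‖z‖ - B)`
  have heval : p.eval z = ∑ k ∈ Finset.range d, p.coeff k * z ^ k + lc * z ^ d := by
    rw [Polynomial.eval_eq_sum_range, Finset.sum_range_succ]
    rfl
  have hzd : ‖z‖ ≤ ‖z‖ ^ d := le_self_pow₀ hz1.le hp.ne'
  have hlow : ‖z‖ * ‖∑ k ∈ Finset.range d, p.coeff k * z ^ k‖ ≤ B * ‖z‖ ^ d := by
    have h1 : ‖∑ k ∈ Finset.range d, p.coeff k * z ^ k‖ ≤ ∑ k ∈ Finset.range d, ‖p.coeff k‖ * ‖z‖ ^ k :=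
      (norm_sum_le _ _).trans (Finset.sum_le_sum fun k _ => by rw [norm_mul, norm_pow])
    have h2 : ∀ k ∈ Finset.range d, ‖z‖ * (‖p.coeff k‖ * ‖z‖ ^ k) ≤ ‖p.coeff k‖ * ‖z‖ ^ d := by
      intro k hk
      have hk' : k + 1 ≤ d := Finset.mem_range.1 hk
      have hpow : ‖z‖ ^ (k + 1) ≤ ‖z‖ ^ d := pow_le_pow_right₀ hz1.le hk'
      rw [pow_succ] at hpow
      have := norm_nonneg (p.coeff k)
      nlinarith
    calc ‖z‖ * ‖∑ k ∈ Finset.range d, p.coeff k * z ^ k‖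
        ≤ ‖z‖ * ∑ k ∈ Finset.range d, ‖p.coeff k‖ * ‖z‖ ^ k :=
          mul_le_mul_of_nonneg_left h1 (norm_nonneg _)
      _ = ∑ k ∈ Finset.range d, ‖z‖ * (‖p.coeff k‖ * ‖z‖ ^ k) := by rw [Finset.mul_sum]
      _ ≤ ∑ k ∈ Finset.range d, ‖p.coeff k‖ * ‖z‖ ^ d := Finset.sum_le_sum h2
      _ = B * ‖z‖ ^ d := by rw [hB, Finset.sum_mul]
  have htop : ‖lc * z ^ d‖ = ‖lc‖ * ‖z‖ ^ d := by rw [norm_mul, norm_pow]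
  have htri : ‖lc * z ^ d‖ - ‖∑ k ∈ Finset.range d, p.coeff k * z ^ k‖ ≤ ‖p.eval z‖ := by
    rw [heval]
    have := norm_sub_norm_le (lc * z ^ d) (-(∑ k ∈ Finset.range d, p.coeff k * z ^ k))
    rw [norm_neg, sub_neg_eq_add, add_comm] at this
    linarith
  have hzpos : 0 < ‖z‖ := by linarith
  have hzdpos : 0 < ‖z‖ ^ d := pow_pos hzpos d
  -- `‖z‖ (‖lc‖‖z‖ - B) ≤ ‖z‖^d (‖lc‖‖z‖ - B) ≤ ‖z‖ ‖p(z)‖`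
  have h1 : ‖z‖ ^ d * (‖lc‖ * ‖z‖ - B) ≤ ‖z‖ * ‖p.eval z‖ := by
    have := mul_le_mul_of_nonneg_left htri hzpos.le
    nlinarith [htop, hlow]
  have h2 : ‖z‖ * (‖lc‖ * ‖z‖ - B) ≤ ‖z‖ ^ d * (‖lc‖ * ‖z‖ - B) :=
    mul_le_mul_of_nonneg_right hzd (by linarith)
  have h3 : ‖lc‖ * ‖z‖ - B ≤ ‖p.eval z‖ := le_of_mul_le_mul_left (h2.trans h1) hzpos
  have h4 : ‖z‖ ≤ (‖p.eval z‖ + B) / ‖lc‖ := by rw [le_div_iff₀ hlc0]; linarith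
  calc ‖z‖ ≤ (‖p.eval z‖ + B) / ‖lc‖ := h4
    _ = ‖p.eval z‖ * (1 / ‖lc‖) + B / ‖lc‖ := by ring
    _ ≤ ‖p.eval z‖ * (1 + (B + 1) / ‖lc‖) + (1 + (B + 1) / ‖lc‖) := by
        have ha : 1 / ‖lc‖ ≤ 1 + (B + 1) / ‖lc‖ := by
          have : 1 / ‖lc‖ ≤ (B + 1) / ‖lc‖ := div_le_div_of_nonneg_right (by linarith) hlc0.le
          linarith
        have hb : B / ‖lc‖ ≤ 1 + (B + 1) / ‖lc‖ := by
          have : B / ‖lc‖ ≤ (B + 1) / ‖lc‖ := div_le_div_of_nonneg_right (by linarith) hlc0.le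
          linarith
        have := norm_nonneg (p.eval z)
        nlinarith
    _ = (1 + (B + 1) / ‖lc‖) * (1 + ‖p.eval z‖) := by ring

/-- **The set of solutions of `e^t = a(t)` is infinite** (`a ∈ ℂ[t]` nonzero): the moving-polydisc
theorem in one variable gives a solution near `2πi m + log a(2πi m)` for every large `m`. [folklore] -/
theorem setOf_exp_eq_polynomial_eval_infinite (a : Polynomial ℂ) (ha : a ≠ 0) :
    {t : ℂ | exp t = a.eval t}.Infinite := by
  classical
  have hA : ∀ j : Fin 1, eval (fun i : Fin 1 => 2 * Real.pi * I * (((fun _ => (1 : ℤ)) : Fin 1 → ℤ) i : ℂ))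
      (homogeneousComponent ((fun _ : Fin 1 => a.toMvPolynomial (0 : Fin 1)) j).totalDegree
        ((fun _ : Fin 1 => a.toMvPolynomial (0 : Fin 1)) j)) ≠ 0 := by
    intro j
    exact eval_leadingForm_toMvPolynomial_fin_one_ne_zero ha (by simp [Real.pi_ne_zero, Complex.I_ne_zero])
  have hsol := exists_exp_eq_poly_add_near_latticeCentre (s := 1) (fun _ => (1 : ℤ))
    (fun _ => a.toMvPolynomial (0 : Fin 1)) hA (fun _ _ => 0) (fun _ => differentiable_const _)
    (fun j θ hθ => Eventually.of_forall fun m ξ _ => by rw [norm_zero]; exact hθ.le)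
  intro hfin
  obtain ⟨R, hR⟩ : ∃ R : ℝ, ∀ t ∈ {t : ℂ | exp t = a.eval t}, ‖t‖ ≤ R := by
    obtain ⟨R, hR⟩ := hfin.isBounded.subset_closedBall 0
    exact ⟨R, fun t ht => by simpa using hR ht⟩
  -- a solution far out
  obtain ⟨m, hm, hmR⟩ := (hsol.and (eventually_gt_atTop (Nat.ceil ((R + Real.pi + 1) / (2 * Real.pi))))).exists
  obtain ⟨x, hx, hxsol⟩ := hm
  set t := x 0 with ht
  have htsol : exp t = a.eval t := by
    have := hxsol 0
    rw [MvPolynomial.eval_toMvPolynomial, add_zero] at this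
    exact this
  have hle := hR t htsol
  -- the centre has imaginary part `2π m + arg(…)`, so `‖t‖ ≥ 2π m - π - 1/2`
  set c : ℂ := (m : ℂ) * (2 * Real.pi * I * ((1 : ℤ) : ℂ)) +
    log (eval (fun _ : Fin 1 => (m : ℂ) * (2 * Real.pi * I * ((1 : ℤ) : ℂ))) (a.toMvPolynomial 0)) with hc
  have hdist : ‖t - c‖ ≤ 1 / 2 := by
    have := norm_le_pi_norm (x - fun i : Fin 1 => (m : ℂ) * (2 * Real.pi * I * (((fun _ => (1 : ℤ)) : Fin 1 → ℤ) i : ℂ)) +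
      log (eval (fun k : Fin 1 => (m : ℂ) * (2 * Real.pi * I * (((fun _ => (1 : ℤ)) : Fin 1 → ℤ) k : ℂ)))
        ((fun _ : Fin 1 => a.toMvPolynomial (0 : Fin 1)) i))) 0
    simp only [Pi.sub_apply] at this
    exact this.trans hx
  have hcim : c.im = 2 * Real.pi * m + arg (eval (fun _ : Fin 1 => (m : ℂ) * (2 * Real.pi * I * ((1 : ℤ) : ℂ)))
      (a.toMvPolynomial 0)) := by
    rw [hc, Complex.add_im, Complex.log_im]
    simp [Complex.mul_im, Complex.mul_re]
    ring
  have harg := Complex.abs_arg_le_pi (eval (fun _ : Fin 1 => (m : ℂ) * (2 * Real.pi * I * ((1 : ℤ) : ℂ)))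
    (a.toMvPolynomial 0))
  have h1 : 2 * Real.pi * m - Real.pi ≤ |c.im| := by
    rw [hcim]
    have := neg_abs_le (arg (eval (fun _ : Fin 1 => (m : ℂ) * (2 * Real.pi * I * ((1 : ℤ) : ℂ)))
      (a.toMvPolynomial 0)))
    exact le_trans (by linarith) (le_abs_self _)
  have h2 : |c.im| ≤ ‖c‖ := Complex.abs_im_le_norm c
  have h3 : ‖c‖ ≤ ‖t‖ + 1 / 2 := by
    have := norm_sub_norm_le c t
    rw [norm_sub_rev] at this
    linarith
  have hmR' : (R + Real.pi + 1) / (2 * Real.pi) < m := by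
    have h' : ((Nat.ceil ((R + Real.pi + 1) / (2 * Real.pi)) : ℕ) : ℝ) < m := by exact_mod_cast hmR
    exact lt_of_le_of_lt (Nat.le_ceil _) h'
  rw [div_lt_iff₀ Real.two_pi_pos] at hmR'
  linarith

end OneVariable

/-! ## Part B. The one-variable balance on a slice, in THEOREM K's format -/

section Slice

/-- **gen 8's balance, packaged for THEOREM K.**  `p, A ∈ ℂ[z]`, `deg p ≥ 2`, `F ≠ 0`: a sequence
of solutions of `e^{z} = A(z) + e^{p(z)} F(e^{p(z)})` with `‖z_m‖ → ∞` and `‖z_m‖^N ≤ e^{Re p(z_m)}`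
eventually for every `N`. (new) [cite: MantovaMasser2023, §1 Further remarks] -/
theorem exists_balance_solutions_for_nearLine (p A : Polynomial ℂ) (hp : 2 ≤ p.natDegree)
    {F : Polynomial ℂ} (hF : F ≠ 0) :
    ∃ z : ℕ → ℂ, Tendsto (fun m => ‖z m‖) atTop atTop ∧
      (∀ᶠ m in atTop, exp (z m) = A.eval (z m) + exp (p.eval (z m)) * F.eval (exp (p.eval (z m)))) ∧
      ∀ N : ℕ, ∀ᶠ m in atTop, ‖z m‖ ^ N ≤ Real.exp (p.eval (z m)).re := by
  classical
  set D : ℕ := p.natDegree with hDdef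
  have hD0 : D ≠ 0 := by omega
  -- solutions with `ρ k^{1/D} ≤ Re p(z)`, `‖p(z)‖ ≤ C k` (both degree cases of gen 8)
  obtain ⟨ρ, C, hρ, hev⟩ : ∃ ρ C : ℝ, 0 < ρ ∧ ∀ᶠ k : ℕ in atTop, ∃ z : ℂ,
      exp z = A.eval z + exp (p.eval z) * F.eval (exp (p.eval z)) ∧
      ρ * (k : ℝ) ^ ((p.natDegree : ℝ)⁻¹) ≤ (p.eval z).re ∧ ‖p.eval z‖ ≤ C * k := by
    rcases Nat.lt_or_ge p.natDegree 3 with h | h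
    · have h2 : p.natDegree = 2 := by omega
      have hlc : p.coeff 2 ≠ 0 := by
        rw [← h2]; exact Polynomial.leadingCoeff_ne_zero.2 (by rintro rfl; simp at h2)
      have hpeq : ∀ z, p.eval z = p.coeff 2 * z ^ 2 + p.coeff 1 * z + p.coeff 0 := by
        intro z
        have : p = Polynomial.C (p.coeff 2) * Polynomial.X ^ 2 + Polynomial.C (p.coeff 1) *
            Polynomial.X + Polynomial.C (p.coeff 0) := by
          conv_lhs => rw [p.as_sum_range_C_mul_X_pow, h2]
          simp [Finset.sum_range_succ]
          ring
        conv_lhs => rw [this]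
        simp
      obtain ⟨ρ, C, hρ, hev⟩ := exists_solution_expExp_quadratic hlc (p.coeff 1) (p.coeff 0) A hF
      refine ⟨ρ, C, hρ, ?_⟩
      filter_upwards [hev] with k hk
      obtain ⟨z, hz, hre, hnorm⟩ := hk
      refine ⟨z, by rw [hpeq]; exact hz, ?_, by rw [hpeq]; exact hnorm⟩
      rw [hpeq, h2, show ((2 : ℕ) : ℝ)⁻¹ = (1 / 2 : ℝ) by norm_num, ← Real.sqrt_eq_rpow]
      exact hre
    · exact exists_solution_expExp_general p h A hF
  obtain ⟨k₀, hk₀⟩ := eventually_atTop.1 hev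
  have hsol : ∀ m : ℕ, ∃ z : ℂ,
      exp z = A.eval z + exp (p.eval z) * F.eval (exp (p.eval z)) ∧
      ρ * (((max (m ^ D) k₀ : ℕ) : ℝ)) ^ ((D : ℝ)⁻¹) ≤ (p.eval z).re ∧
      ‖p.eval z‖ ≤ C * ((max (m ^ D) k₀ : ℕ) : ℝ) := fun m =>
    hk₀ (max (m ^ D) k₀) (le_max_right _ _)
  choose z hz using hsol
  -- for `m^D ≥ k₀`: `Re p(z_m) ≥ ρ m`, `‖p(z_m)‖ ≤ C m^D`
  have hbig : ∀ᶠ m : ℕ in atTop, k₀ ≤ m ^ D := by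
    filter_upwards [eventually_ge_atTop k₀] with m hm
    exact hm.trans (Nat.le_self_pow hD0 m)
  have hre : ∀ᶠ m : ℕ in atTop, ρ * m ≤ (p.eval (z m)).re := by
    filter_upwards [hbig] with m hm
    have h := (hz m).2.1
    rw [max_eq_left hm] at h
    have e : (((m ^ D : ℕ) : ℝ)) ^ ((D : ℝ)⁻¹) = m := by
      push_cast
      rw [← Real.rpow_natCast, ← Real.rpow_mul (Nat.cast_nonneg m), mul_inv_cancel₀
        (by exact_mod_cast hD0), Real.rpow_one]
    rwa [e] at h
  have hnorm : ∀ᶠ m : ℕ in atTop, ‖p.eval (z m)‖ ≤ C * (m : ℝ) ^ D := by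
    filter_upwards [hbig] with m hm
    have h := (hz m).2.2
    rw [max_eq_left hm] at h
    exact_mod_cast h
  have hC0 : 0 ≤ C := by
    obtain ⟨m, hm⟩ := (hnorm.and (eventually_ge_atTop 1)).exists
    have h1 : (0 : ℝ) < (m : ℝ) ^ D := pow_pos (by exact_mod_cast hm.2) D
    nlinarith [norm_nonneg (p.eval (z m)), hm.1]
  -- `‖z‖ ≤ K (1 + ‖p(z)‖)`
  obtain ⟨K, hK, hKz⟩ := exists_norm_le_of_polynomial_eval p (by omega)
  refine ⟨z, ?_, Eventually.of_forall fun m => (hz m).1, fun N => ?_⟩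
  · -- `‖z_m‖ → ∞`: else `‖p(z_m)‖` bounded, against `Re p(z_m) ≥ ρ m`
    obtain ⟨Cp, hCp, Np, hp'⟩ := exists_norm_polynomial_eval_le_pow p
    refine tendsto_atTop.2 fun R => ?_
    filter_upwards [hre, (tendsto_natCast_atTop_atTop.const_mul_atTop hρ).eventually_gt_atTop
      (Cp * (1 + |R|) ^ Np)] with m hm hm2
    by_contra hlt
    rw [not_le] at hlt
    have h1 : ‖p.eval (z m)‖ ≤ Cp * (1 + |R|) ^ Np :=
      (hp' _).trans (mul_le_mul_of_nonneg_left (pow_le_pow_left₀ (by positivity)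
        (by linarith [le_abs_self R]) _) hCp)
    have h2 : (p.eval (z m)).re ≤ ‖p.eval (z m)‖ := Complex.re_le_norm _
    linarith
  · -- `‖z_m‖^N ≤ (K(1+C) m^D)^N ≤ e^{ρ m} ≤ e^{Re p(z_m)}`
    have hKC : 0 < K * (1 + C) := by positivity
    filter_upwards [hre, hnorm, eventually_ge_atTop 1,
      eventually_mul_log_add_le ((N : ℝ) * D) (N * Real.log (K * (1 + C))) hρ] with m hm1 hm2 hm3 hm4
    have hm0 : (0 : ℝ) < m := by exact_mod_cast hm3
    have hmD : (1 : ℝ) ≤ (m : ℝ) ^ D := one_le_pow₀ (by exact_mod_cast hm3)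
    have hzle : ‖z m‖ ≤ K * (1 + C) * (m : ℝ) ^ D := by
      calc ‖z m‖ ≤ K * (1 + ‖p.eval (z m)‖) := hKz _
        _ ≤ K * (1 + C * (m : ℝ) ^ D) := by gcongr
        _ ≤ K * (1 + C) * (m : ℝ) ^ D := by nlinarith [hK.le, hC0]
    have e1 : Real.exp (((D * N : ℕ) : ℝ) * Real.log m) = ((m : ℝ) ^ D) ^ N := by
      rw [Real.exp_nat_mul, Real.exp_log hm0, pow_mul]
    have e2 : Real.exp ((N : ℝ) * Real.log (K * (1 + C))) = (K * (1 + C)) ^ N := by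
      rw [Real.exp_nat_mul, Real.exp_log hKC]
    have hexp : Real.exp ((N : ℝ) * D * Real.log m + N * Real.log (K * (1 + C))) =
        (K * (1 + C) * (m : ℝ) ^ D) ^ N := by
      rw [Real.exp_add, show (N : ℝ) * D * Real.log m = ((D * N : ℕ) : ℝ) * Real.log m by
        push_cast; ring, e1, e2]
      simp only [mul_pow]
      ring
    calc ‖z m‖ ^ N ≤ (K * (1 + C) * (m : ℝ) ^ D) ^ N := pow_le_pow_left₀ (norm_nonneg _) hzle N
      _ = Real.exp ((N : ℝ) * D * Real.log m + N * Real.log (K * (1 + C))) := hexp.symm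
      _ ≤ Real.exp (ρ * m) := Real.exp_le_exp.2 hm4
      _ ≤ Real.exp (p.eval (z m)).re := Real.exp_le_exp.2 hm1

end Slice

end Summit.Schanuel.Schanuel.Theorems

end
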